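import Summits.NavierStokesRegularity.NavierStokesRegularity.Theorems.PumpContinuationEulerProximatePumpTransfer
import Summits.NavierStokesRegularity.NavierStokesRegularity.Theorems.PumpContinuationEulerProximatePumpTruncationBridgeTypeI
import HarnessLib

/-!
# Route `PumpContinuation`, crux `EulerProximatePump` (stmt-NavierStokesRegularity-18302), line
  `SketchIdeator2` — the Door is downstream of the Type-I DSS Liouville wall alone

With the Type-I truncation bridge `DssTruncationBridgeTypeI` (item stmt-NavierStokesRegularity-14478) now a
theorem of the tree (`dssTruncationBridgeTypeI_proof`,
`Theorems/PumpContinuationEulerProximatePumpTruncationBridgeTypeI.lean`), the transfer line of the crux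
collapses to a ONE-hypothesis conditional, recorded here as importable, sorry-free theorems:

* `nsTypeIMildBlowup_of_blowupTypeIDssProfile` — failure of Tsai's Type-I (rotated) `λ`-DSS Liouville
  conjecture (`BlowupTypeIDssProfile`, the shared wall item stmt-NavierStokesRegularity-0155 of routes `Blowup` /
  `DssFarFieldSlaving`) gives a Schwartz-data `H¹⁰_df`-mild Type-I blow-up of the true Navier–Stokes form `B`
  (Tao 2016 (1.5), `ν = 1`) at some ceiling `M` with no mild extension (the truncation bridge with the rate,
  then the landed `stub_classicalTypeIToMild`);
* `eulerProximatePump_of_blowupTypeIDssProfile` — hence the Door `EulerProximatePump` (Euler datum, segment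
  collapsed: `stub_transfer`).

So `EulerProximatePump` is kernel-checked CONDITIONALLY on exactly the wall stmt-0155 and nothing else; the file
ends with the registered stub `stub_doorOfDssProfile` carrying that implication.

## References

* T. Tao, J. Amer. Math. Soc. 29 (2016), arXiv:1402.0290v3, §1.1 (1.5), (1.13), (1.15). [Tao2016AveragedNS]
* Z. Bradshaw, T.-P. Tsai, Comm. PDE 42 (2017) = arXiv:1610.05680, §5 Open Problem 5.1. [BradshawTsai2017CPDE]
-/

noncomputable section

open MeasureTheory Set Filter
open scoped ENNReal

-- the nested summit namespace `…NavierStokesRegularity.NavierStokesRegularity…` is the tree's layout (D-0017)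
set_option linter.dupNamespace false

namespace Summit.NavierStokesRegularity.NavierStokesRegularity.Theorems

open Literature.Analysis.FluidPDE Literature.Analysis.FluidPDE.Tao2016 PumpContinuationEulerProximatePump

/-- **¬(Tsai's Type-I RDSS Liouville conjecture) ⇒ NSTypeI**: if the wall `BlowupTypeIDssProfile`
(stmt-NavierStokesRegularity-0155) holds, i.e. some nontrivial Type-I (rotated) `λ`-DSS ancient mild solution
exists, then the true Navier–Stokes form `B` has a Schwartz-data `H¹⁰_df`-mild solution on some `[0, S)` obeying
the Type-I bound `‖u t‖_∞ ≤ M/√(S − t)` with NO mild extension past `S` (the truncation bridge with the rate,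
`dssTruncationBridgeTypeI_proof`, followed by `stub_classicalTypeIToMild`). [cite: BradshawTsai2017CPDE, §5 Open Problem 5.1] -/
theorem nsTypeIMildBlowup_of_blowupTypeIDssProfile
    (hP : Theses.DssFarFieldSlaving.BlowupTypeIDssProfile) :
    ∃ M : ℝ, ∃ u₀ : SchwartzMap (EuclideanSpace ℝ (Fin 3)) (EuclideanSpace ℝ (Fin 3)),
        VectorCalculus.IsDivFree ⇑u₀ ∧ ∃ S : ℝ, 0 < S ∧ ∃ U : ℝ → L2C,
          IsMildSolutionFor eulerForm (schwartzL2 u₀) (Ico 0 S) U ∧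
          (∀ t ∈ Ico 0 S, eLpNorm (U t) ⊤ volume ≤ ENNReal.ofReal (M / Real.sqrt (S - t))) ∧
          ¬ ∃ S' : ℝ, S < S' ∧ ∃ v : ℝ → L2C,
              IsMildSolutionFor eulerForm (schwartzL2 u₀) (Ico 0 S') v ∧ ∀ t ∈ Ico 0 S, v t = U t := by
  obtain ⟨ν, hν, T, hT, u, p, hmax, hLH, hdec, hI⟩ := dssTruncationBridgeTypeI_proof hP
  exact stub_classicalTypeIToMild ν hν T hT u p hmax hLH hdec hI

/-- **¬(Tsai's Type-I RDSS Liouville conjecture) ⇒ the Door**: `EulerProximatePump`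
(stmt-NavierStokesRegularity-18302) follows from the wall `BlowupTypeIDssProfile` (stmt-NavierStokesRegularity-0155)
alone — NSTypeI from the wall (`nsTypeIMildBlowup_of_blowupTypeIDssProfile`), then the Euler-datum collapse
of the segment (`pumpContinuation_eulerProximatePump_of_nsTypeI`); definitionally the line's composition
`stub_transfer hP stub_dssTruncationBridgeTypeI`. [cite: Tao2016AveragedNS, §1.1 (1.5) and (1.13)] -/
theorem eulerProximatePump_of_blowupTypeIDssProfile
    (hP : Theses.DssFarFieldSlaving.BlowupTypeIDssProfile) : Theses.PumpContinuation.EulerProximatePump :=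
  pumpContinuation_eulerProximatePump_of_nsTypeI (nsTypeIMildBlowup_of_blowupTypeIDssProfile hP)

namespace PumpContinuationEulerProximatePump

/-- **Registered stub `stub_doorOfDssProfile`** (line `SketchIdeator2`, crux `EulerProximatePump`,
stmt-NavierStokesRegularity-18302): the Door is downstream of the wall stmt-0155 alone
(`eulerProximatePump_of_blowupTypeIDssProfile`). [cite: Tao2016AveragedNS, §1.1 (1.5) and (1.13)] -/
theorem stub_doorOfDssProfile :
    Summit.NavierStokesRegularity.NavierStokesRegularity.Theses.DssFarFieldSlaving.BlowupTypeIDssProfile →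
      Summit.NavierStokesRegularity.NavierStokesRegularity.Theses.PumpContinuation.EulerProximatePump :=
  eulerProximatePump_of_blowupTypeIDssProfile

end PumpContinuationEulerProximatePump

end Summit.NavierStokesRegularity.NavierStokesRegularity.Theorems

end
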